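import Mathlib
import Summits.Ventures.HodgeRepro.Tier4.Common.AdelicDefs
import Summits.Ventures.HodgeRepro.Tier4.Line1.PlaneDefs
import Summits.Ventures.HodgeRepro.Tier4.Line4.RationalLineScalars

/-!
# Tier4/Line4/QuadraticScalars — the field `E′ = k[Ω] = k[X]/(X² + d)`, its conjugation, and the NORMALISATION of a
regular block matrix by the norm-one tori

Blind re-derivation cell `pub-hodge-repro`, Tier 4 «PROVE THE STEP» (README §9–§10), LINE L4, cut C-L4-TAIL (S2′)(ii)
— the FIBRE BOUND (lead (R-27) S15050; TAKEN S15052), seat t4-L2-p3 (gen 4); module 3 (the scalar algebra in the field).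

* `E′ := AdjoinRoot (X² + C d)` is a FIELD when `−d` is not a square (`irreducible_X_sq_add_C`); `conjE` is the
  `k`-automorphism `root ↦ −root`, an involution; `toMat W hΩ : E′ →ₐ[k] M₄(k)` sends `root ↦ Ω`, so
  `toMat (of x + of y · root) = escK x y` and `toMat (conjE z)` is the conjugate scalar;
* `exists_coords_E'`: every element of `E′` is `u + v · root` (division by the monic `X² + d`); the norm of a
  norm-one element has `nrmK = 1` coordinates; `mul_conjE_coords`: `(x + y root)(x′ − y′ root)` in coordinates;
* **`exists_normalise`** — the algebraic heart of the fibre bound, in the field: two `2 × 2` block-scalar matrices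
  `s, s′` over `E′` with all entries non-zero, satisfying the SAME hermitian relations
  `Σ_j s_ij σ(s_i′j) b_j = δ_ii′ a_i` (`σ` = conjugation, `a₀ ≠ 0`, `b_j ≠ 0` fixed by `σ`) and with `N(s′₀₀) = N(s₀₀)`,
  differ by norm-one scalars on the rows and columns: `s′_ij = ε_i s_ij ε′_j`, `N(ε_i) = N(ε′_j) = 1` — the
  relations force `N(s_01)`, `N(s_11)`, `N(s_10)` from `N(s_00)`, Hilbert 90 for the norm-one group normalises
  `s_00`, `s_01`, `s_10`, and the cross relation forces `s_11`.

Mathlib + the landed modules only; no printed input; nothing here asserts anything about the truth of (P);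
HC_CM is NOT proved by anyone in this repository.
-/

set_option autoImplicit false

noncomputable section

namespace Summit.Ventures.HodgeRepro.Tier4.Line4

open Summit.Ventures.HodgeRepro.Tier4 Summit.Ventures.HodgeRepro.Tier4.Common
  Summit.Ventures.HodgeRepro.Tier4.Line1 Matrix Polynomial

variable {k : Type} [Field k]

/-! ## 1. The field `E′ = k[X]/(X² + d)` and its conjugation -/

/-- `X² + d` is irreducible over `k` when `−d` is not a square (a quadratic with no root) -/
theorem irreducible_X_sq_add_C {d : k} (hd : ¬ IsSquare (-d)) : Irreducible ((X : k[X]) ^ 2 + C d) := by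
  rw [irreducible_iff_roots_eq_zero_of_degree_le_three (by rw [natDegree_X_pow_add_C])
    (by rw [natDegree_X_pow_add_C]; norm_num)]
  rw [Multiset.eq_zero_iff_forall_notMem]
  intro r hr
  rw [mem_roots (X_pow_add_C_ne_zero two_pos d), IsRoot.def, eval_add, eval_pow, eval_X, eval_C] at hr
  exact hd ⟨r, by linear_combination -hr⟩

/-- `root² = −d` in `E′` -/
theorem root_sq (d : k) :
    AdjoinRoot.root ((X : k[X]) ^ 2 + C d) ^ 2 = -algebraMap k (AdjoinRoot ((X : k[X]) ^ 2 + C d)) d := by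
  have h := AdjoinRoot.eval₂_root ((X : k[X]) ^ 2 + C d)
  rw [eval₂_add, eval₂_pow, eval₂_X, eval₂_C] at h
  rw [eq_neg_iff_add_eq_zero]
  exact h

/-- **the conjugation** of `E′`: the `k`-automorphism `root ↦ −root` -/
def conjE (d : k) : AdjoinRoot ((X : k[X]) ^ 2 + C d) →ₐ[k] AdjoinRoot ((X : k[X]) ^ 2 + C d) :=
  AdjoinRoot.liftAlgHom _ (Algebra.ofId k _) (-AdjoinRoot.root _) (by
    rw [eval₂_add, eval₂_pow, eval₂_X, eval₂_C, neg_sq, root_sq]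
    simp)

/-- `conjE` sends `root` to `−root` -/
theorem conjE_root (d : k) :
    conjE d (AdjoinRoot.root ((X : k[X]) ^ 2 + C d)) = -AdjoinRoot.root ((X : k[X]) ^ 2 + C d) :=
  AdjoinRoot.liftAlgHom_root _ _ _ _

/-- `conjE` fixes the scalars of `k` -/
theorem conjE_algebraMap (d x : k) :
    conjE d (algebraMap k (AdjoinRoot ((X : k[X]) ^ 2 + C d)) x) = algebraMap k _ x :=
  AlgHom.commutes _ _

/-- the conjugation is an involution -/
theorem conjE_conjE (d : k) (z : AdjoinRoot ((X : k[X]) ^ 2 + C d)) : conjE d (conjE d z) = z := by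
  have h : (conjE d).comp (conjE d) = AlgHom.id k _ := by
    apply AdjoinRoot.algHom_ext
    simp only [AlgHom.comp_apply, conjE_root, map_neg, neg_neg, AlgHom.id_apply]
  exact congrArg (fun g => g z) h

/-- the conjugation is injective -/
theorem conjE_injective (d : k) : Function.Injective (conjE d) := by
  intro z w h
  rw [← conjE_conjE d z, h, conjE_conjE]

/-- the conjugate of `x + y · root` -/
theorem conjE_of_add_mul_root (d x y : k) :
    conjE d (algebraMap k _ x + algebraMap k _ y * AdjoinRoot.root ((X : k[X]) ^ 2 + C d)) =
      algebraMap k _ x + algebraMap k _ (-y) * AdjoinRoot.root ((X : k[X]) ^ 2 + C d) := by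
  rw [map_add, map_mul, conjE_algebraMap, conjE_algebraMap, conjE_root, map_neg]
  ring

/-- the norm of `x + y · root` is `x² + d y²` -/
theorem mul_conjE_of_add_mul_root (d x y : k) :
    (algebraMap k _ x + algebraMap k _ y * AdjoinRoot.root ((X : k[X]) ^ 2 + C d)) *
      conjE d (algebraMap k _ x + algebraMap k _ y * AdjoinRoot.root ((X : k[X]) ^ 2 + C d)) =
      algebraMap k _ (nrmK d x y) := by
  rw [conjE_of_add_mul_root]
  have h := root_sq d
  simp only [nrmK, map_add, map_mul, map_neg]
  linear_combination (-(algebraMap k (AdjoinRoot ((X : k[X]) ^ 2 + C d)) y) ^ 2) * h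

/-! ## 2. The embedding `E′ → M₄(k)`, `root ↦ Ω` -/

variable (W : PlaneData k)

/-- the ring map `E′ → M₄(k)` sending `root` to `Ω` (`Ideal.Quotient.lift` of the non-commutative `eval₂`) -/
def toMat {d : k} (hΩ : W.Ω * W.Ω = -(d • (1 : Matrix (Fin 4) (Fin 4) k))) :
    AdjoinRoot ((X : k[X]) ^ 2 + C d) →+* Matrix (Fin 4) (Fin 4) k :=
  Ideal.Quotient.lift _
    (eval₂RingHom' (algebraMap k (Matrix (Fin 4) (Fin 4) k)) W.Ω fun a => Algebra.commute_algebraMap_left a W.Ω)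
    (fun g hg => by
      obtain ⟨q, hq⟩ := Ideal.mem_span_singleton'.1 hg
      rw [← hq, map_mul]
      simp only [eval₂RingHom'_apply, eval₂_add, eval₂_X_pow, eval₂_C]
      rw [show W.Ω ^ 2 = W.Ω * W.Ω from sq _, hΩ, Algebra.algebraMap_eq_smul_one, neg_add_cancel, mul_zero])

/-- `toMat` sends `root` to `Ω` -/
theorem toMat_root {d : k} (hΩ : W.Ω * W.Ω = -(d • (1 : Matrix (Fin 4) (Fin 4) k))) :
    toMat W hΩ (AdjoinRoot.root ((X : k[X]) ^ 2 + C d)) = W.Ω := by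
  show Ideal.Quotient.lift _ _ _ (Ideal.Quotient.mk _ (X : k[X])) = W.Ω
  rw [Ideal.Quotient.lift_mk, eval₂RingHom'_apply, eval₂_X]

/-- `toMat` sends a scalar of `k` to the scalar matrix -/
theorem toMat_algebraMap {d : k} (hΩ : W.Ω * W.Ω = -(d • (1 : Matrix (Fin 4) (Fin 4) k))) (x : k) :
    toMat W hΩ (algebraMap k (AdjoinRoot ((X : k[X]) ^ 2 + C d)) x) = x • (1 : Matrix (Fin 4) (Fin 4) k) := by
  show Ideal.Quotient.lift _ _ _ (Ideal.Quotient.mk _ (C x)) = _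
  rw [Ideal.Quotient.lift_mk, eval₂RingHom'_apply, eval₂_C, Algebra.algebraMap_eq_smul_one]

/-- `toMat (x + y · root) = escK x y` -/
theorem toMat_of_add_mul_root {d : k} (hΩ : W.Ω * W.Ω = -(d • (1 : Matrix (Fin 4) (Fin 4) k))) (x y : k) :
    toMat W hΩ (algebraMap k _ x + algebraMap k _ y * AdjoinRoot.root ((X : k[X]) ^ 2 + C d)) = escK W x y := by
  rw [map_add, map_mul, toMat_algebraMap, toMat_algebraMap, toMat_root, escK, smul_mul_assoc, one_mul]

/-! ## 3. Coordinates in `E′` -/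

/-- every element of `E′` is `u + v · root` -/
theorem exists_coords_E' (d : k) (z : AdjoinRoot ((X : k[X]) ^ 2 + C d)) :
    ∃ u v : k, z = algebraMap k _ u + algebraMap k _ v * AdjoinRoot.root ((X : k[X]) ^ 2 + C d) := by
  induction z using AdjoinRoot.induction_on with
  | ih p =>
    have hmonic : ((X : k[X]) ^ 2 + C d).Monic := monic_X_pow_add_C d two_ne_zero
    have hne1 : ((X : k[X]) ^ 2 + C d) ≠ 1 := by
      intro h
      have := congrArg natDegree h
      rw [natDegree_X_pow_add_C, natDegree_one] at this
      exact two_ne_zero this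
    have hdeg : (p %ₘ ((X : k[X]) ^ 2 + C d)).natDegree ≤ 1 := by
      have := natDegree_modByMonic_lt p hmonic hne1
      rw [natDegree_X_pow_add_C] at this
      omega
    set r : k[X] := p %ₘ ((X : k[X]) ^ 2 + C d) with hr
    have hrep : r = C (r.coeff 1) * X + C (r.coeff 0) := eq_X_add_C_of_natDegree_le_one hdeg
    refine ⟨r.coeff 0, r.coeff 1, ?_⟩
    have hmk : AdjoinRoot.mk ((X : k[X]) ^ 2 + C d) p = AdjoinRoot.mk ((X : k[X]) ^ 2 + C d) r := by
      rw [AdjoinRoot.mk_eq_mk]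
      refine ⟨p /ₘ ((X : k[X]) ^ 2 + C d), ?_⟩
      have := modByMonic_add_div p ((X : k[X]) ^ 2 + C d)
      rw [hr]
      linear_combination -this
    rw [hmk]
    conv_lhs => rw [hrep]
    rw [map_add, map_mul, AdjoinRoot.mk_C, AdjoinRoot.mk_C, AdjoinRoot.mk_X, AdjoinRoot.algebraMap_eq]
    ring

/-- a norm-one element of `E′` has `nrmK = 1` coordinates -/
theorem nrmK_eq_one_of_mul_conjE_eq_one {d : k} {u v : k}
    (h : (algebraMap k _ u + algebraMap k _ v * AdjoinRoot.root ((X : k[X]) ^ 2 + C d)) *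
      conjE d (algebraMap k _ u + algebraMap k _ v * AdjoinRoot.root ((X : k[X]) ^ 2 + C d)) = 1) :
    nrmK d u v = 1 := by
  rw [mul_conjE_of_add_mul_root] at h
  have hinj : Function.Injective (AdjoinRoot.of ((X : k[X]) ^ 2 + C d)) := by
    apply AdjoinRoot.of.injective_of_degree_ne_zero
    rw [degree_eq_natDegree (X_pow_add_C_ne_zero two_pos d), natDegree_X_pow_add_C]
    norm_num
  apply hinj
  rw [← AdjoinRoot.algebraMap_eq, h, map_one]

/-- the product with a conjugate, in coordinates -/
theorem mul_conjE_coords (d x y x' y' : k) :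
    (algebraMap k _ x + algebraMap k _ y * AdjoinRoot.root ((X : k[X]) ^ 2 + C d)) *
      conjE d (algebraMap k _ x' + algebraMap k _ y' * AdjoinRoot.root ((X : k[X]) ^ 2 + C d)) =
      algebraMap k _ (x * x' + d * (y * y')) +
        algebraMap k _ (y * x' - x * y') * AdjoinRoot.root ((X : k[X]) ^ 2 + C d) := by
  rw [conjE_of_add_mul_root]
  have h := root_sq d
  simp only [map_add, map_mul, map_sub, map_neg]
  linear_combination (-(algebraMap k (AdjoinRoot ((X : k[X]) ^ 2 + C d)) y *
    algebraMap k (AdjoinRoot ((X : k[X]) ^ 2 + C d)) y')) * h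

/-! ## 4. The normalisation lemma, in the field -/

section Normalise

variable {d : k} [Fact (Irreducible ((X : k[X]) ^ 2 + C d))]

local notation "E'" => AdjoinRoot ((X : k[X]) ^ 2 + C d)

/-- the norm of a non-zero element is non-zero -/
theorem mul_conjE_ne_zero {z : E'} (hz : z ≠ 0) : z * conjE d z ≠ 0 :=
  mul_ne_zero hz ((_root_.map_ne_zero _).2 hz)

/-- **THE NORMALISATION LEMMA**: two regular block-scalar matrices over `E′` satisfying the same hermitian relations,
with equal `(0,0)`-norms, differ by norm-one row and column scalars. -/
theorem exists_normalise {s s' : Fin 2 → Fin 2 → E'} {a b : Fin 2 → E'}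
    (hb : ∀ j, b j ≠ 0) (hbσ : ∀ j, conjE d (b j) = b j) (ha0 : a 0 ≠ 0)
    (hs : ∀ i j, s i j ≠ 0) (hs' : ∀ i j, s' i j ≠ 0)
    (R00 : s 0 0 * conjE d (s 0 0) * b 0 + s 0 1 * conjE d (s 0 1) * b 1 = a 0)
    (R11 : s 1 0 * conjE d (s 1 0) * b 0 + s 1 1 * conjE d (s 1 1) * b 1 = a 1)
    (R01 : s 0 0 * conjE d (s 1 0) * b 0 + s 0 1 * conjE d (s 1 1) * b 1 = 0)
    (R00' : s' 0 0 * conjE d (s' 0 0) * b 0 + s' 0 1 * conjE d (s' 0 1) * b 1 = a 0)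
    (R11' : s' 1 0 * conjE d (s' 1 0) * b 0 + s' 1 1 * conjE d (s' 1 1) * b 1 = a 1)
    (R01' : s' 0 0 * conjE d (s' 1 0) * b 0 + s' 0 1 * conjE d (s' 1 1) * b 1 = 0)
    (h00 : s' 0 0 * conjE d (s' 0 0) = s 0 0 * conjE d (s 0 0)) :
    ∃ ε ε' : Fin 2 → E', (∀ i, ε i * conjE d (ε i) = 1) ∧ (∀ j, ε' j * conjE d (ε' j) = 1) ∧
      ∀ i j, s' i j = ε i * s i j * ε' j := by
  have hσne : ∀ z : E', z ≠ 0 → conjE d z ≠ 0 := fun z hz => (_root_.map_ne_zero _).2 hz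
  -- the norms of the entries of `s` are determined by `N(s₀₀)` and the relations
  have hN01 : s' 0 1 * conjE d (s' 0 1) = s 0 1 * conjE d (s 0 1) := by
    have h1 : (s' 0 1 * conjE d (s' 0 1) - s 0 1 * conjE d (s 0 1)) * b 1 = 0 := by
      linear_combination R00' - R00 - b 0 * h00
    exact sub_eq_zero.1 ((mul_eq_zero.1 h1).resolve_right (hb 1))
  -- `N(t₁₁) b₁ a₀ = N(t₀₀) a₁ b₀` from the three relations
  have key : ∀ (t : Fin 2 → Fin 2 → E'),
      t 0 0 * conjE d (t 0 0) * b 0 + t 0 1 * conjE d (t 0 1) * b 1 = a 0 →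
      t 1 0 * conjE d (t 1 0) * b 0 + t 1 1 * conjE d (t 1 1) * b 1 = a 1 →
      t 0 0 * conjE d (t 1 0) * b 0 + t 0 1 * conjE d (t 1 1) * b 1 = 0 →
      t 1 1 * conjE d (t 1 1) * b 1 * a 0 = t 0 0 * conjE d (t 0 0) * a 1 * b 0 := by
    intro t T00 T11 T01
    -- the conjugate of the cross relation
    have T01σ : conjE d (t 0 0) * t 1 0 * b 0 + conjE d (t 0 1) * t 1 1 * b 1 = 0 := by
      have := congrArg (conjE d) T01
      simp only [map_add, map_mul, map_zero, hbσ, conjE_conjE] at this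
      exact this
    -- `N(t₀₁) N(t₁₁) b₁² = N(t₀₀) N(t₁₀) b₀²`
    have E1 : t 0 1 * conjE d (t 0 1) * (t 1 1 * conjE d (t 1 1)) * (b 1 * b 1) =
        t 0 0 * conjE d (t 0 0) * (t 1 0 * conjE d (t 1 0)) * (b 0 * b 0) := by
      linear_combination (conjE d (t 0 1) * t 1 1 * b 1) * T01 - (t 0 0 * conjE d (t 1 0) * b 0) * T01σ
    linear_combination (-(t 1 1 * conjE d (t 1 1) * b 1)) * T00 + (t 0 0 * conjE d (t 0 0) * b 0) * T11 + E1
  have hN11 : s' 1 1 * conjE d (s' 1 1) = s 1 1 * conjE d (s 1 1) := by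
    have h1 := key s R00 R11 R01
    have h2 := key s' R00' R11' R01'
    have h3 : (s' 1 1 * conjE d (s' 1 1) - s 1 1 * conjE d (s 1 1)) * (b 1 * a 0) = 0 := by
      linear_combination h2 - h1 + (a 1 * b 0) * h00
    exact sub_eq_zero.1 ((mul_eq_zero.1 h3).resolve_right (mul_ne_zero (hb 1) ha0))
  have hN10 : s' 1 0 * conjE d (s' 1 0) = s 1 0 * conjE d (s 1 0) := by
    have h1 : (s' 1 0 * conjE d (s' 1 0) - s 1 0 * conjE d (s 1 0)) * b 0 = 0 := by
      linear_combination R11' - R11 - b 1 * hN11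
    exact sub_eq_zero.1 ((mul_eq_zero.1 h1).resolve_right (hb 0))
  -- the normalising scalars
  set ε0 : E' := s' 0 0 / s 0 0 with hε0
  set ε1 : E' := s' 1 0 / s 1 0 with hε1
  set ε1' : E' := s' 0 1 / (ε0 * s 0 1) with hε1'
  have hε0ne : ε0 ≠ 0 := div_ne_zero (hs' 0 0) (hs 0 0)
  have hε1'ne : ε1' ≠ 0 := div_ne_zero (hs' 0 1) (mul_ne_zero hε0ne (hs 0 1))
  have hε0n : ε0 * conjE d ε0 = 1 := by
    rw [hε0, map_div₀, div_mul_div_comm, h00, div_self (mul_conjE_ne_zero (hs 0 0))]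
  have hε1n : ε1 * conjE d ε1 = 1 := by
    rw [hε1, map_div₀, div_mul_div_comm, hN10, div_self (mul_conjE_ne_zero (hs 1 0))]
  have hε1'n : ε1' * conjE d ε1' = 1 := by
    rw [hε1', map_div₀, div_mul_div_comm, hN01, map_mul, show ε0 * s 0 1 * (conjE d ε0 * conjE d (s 0 1)) =
      (ε0 * conjE d ε0) * (s 0 1 * conjE d (s 0 1)) by ring, hε0n, one_mul,
      div_self (mul_conjE_ne_zero (hs 0 1))]
  refine ⟨![ε0, ε1], ![1, ε1'], ?_, ?_, ?_⟩
  · intro i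
    fin_cases i
    · exact hε0n
    · exact hε1n
  · intro j
    fin_cases j
    · simp
    · exact hε1'n
  -- the four entries
  have e00 : s' 0 0 = ε0 * s 0 0 := by
    have h := hs 0 0
    rw [hε0]; field_simp
  have e10 : s' 1 0 = ε1 * s 1 0 := by
    have h := hs 1 0
    rw [hε1]; field_simp
  have e01 : s' 0 1 = ε0 * s 0 1 * ε1' := by
    have h := hs 0 1
    rw [hε1']; field_simp
  have e11 : s' 1 1 = ε1 * s 1 1 * ε1' := by
    -- the cross relation for `s′` through `e00`, `e10`, `e01`: `ε′₁ σ(s′₁₁) = σ(ε₁) σ(s₁₁)`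
    have P : ε0 * s 0 0 * (conjE d ε1 * conjE d (s 1 0)) * b 0 +
        ε0 * s 0 1 * ε1' * conjE d (s' 1 1) * b 1 = 0 := by
      have := R01'
      rw [e00, e10, e01, map_mul] at this
      exact this
    have h1 : ε0 * s 0 1 * b 1 * (ε1' * conjE d (s' 1 1) - conjE d ε1 * conjE d (s 1 1)) = 0 := by
      linear_combination P - (ε0 * conjE d ε1) * R01
    have h2 : ε1' * conjE d (s' 1 1) = conjE d ε1 * conjE d (s 1 1) :=
      sub_eq_zero.1 ((mul_eq_zero.1 h1).resolve_left (mul_ne_zero (mul_ne_zero hε0ne (hs 0 1)) (hb 1)))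
    -- `σ(ε′₁) = ε′₁⁻¹` (norm one)
    have hσε1' : conjE d ε1' = ε1'⁻¹ := eq_inv_of_mul_eq_one_right hε1'n
    have h3 : conjE d (s' 1 1) = conjE d (ε1 * s 1 1 * ε1') := by
      rw [map_mul, map_mul, hσε1', ← h2]
      field_simp
    exact conjE_injective d h3
  intro i j
  fin_cases i <;> fin_cases j
  · simpa using e00
  · simpa using e01
  · simpa using e10
  · simpa using e11

end Normalise

end Summit.Ventures.HodgeRepro.Tier4.Line4

end
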